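import Summits.QuantumFields.YangMills.Theorems.UnitScaleTiltProp8NestedCriticality
import HarnessLib

/-!
# Route `UnitScaleTilt`, crux K1 child «MinimiserStabilityRegPr» (stmt-QuantumFields-19200), registered stub `stub_prop8` (v5 98cb23610ad721f5; leaf V2
# «[Balaban1985Variational] Prop. 8 at the d = 3 carriers») — sub-lemma V2-EL, part 3: THE EULER–LAGRANGE EQUATION ALONG DIFFERENTIABLE CURVES
# (little-o form: a curve of competitors through a minimiser that is differentiable at `t = 0` in the multiplicative chart has `Lin_{U₀}(velocity) = 0`)
# AND THE DIFFERENTIABILITY OF LIPSCHITZ IMPLICIT SOLUTIONS (the abstract calculus lemma that makes the corrected central bonds of a fibre curve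
# differentiable at `t = 0`)

Cell `ym3-torus` ∕ fleet seat `ym-ust-19200-p2` (HUMAN RULING D-0037, YM ladder rung R3), successor g3.  WHERE THIS SITS.  Part 2 (`UnitScaleTiltProp8NestedCriticality`)
proved the Euler–Lagrange equation along curves with a UNIFORM `O(t²)` defect.  The curves the one-step fibre actually carries are obtained by correcting the
central crossing bonds with the exact corrector (`BlockAvgCorrector.exists_eq_of_near`, a Banach fixed point), whose output is known to be LIPSCHITZ in the
data but not `C^{1,1}`; differentiability at `t = 0` is what the implicit-function argument gives (§2 below, from the Fréchet differentiability of the guarded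
fibre map and the invertibility of its central-bond partial derivative), and differentiability at `t = 0` is exactly a little-o defect.  §1 is therefore the
Euler–Lagrange equation in the form the fibre curves meet: `Lin_{U₀}(ξ) = 0` whenever `γ(t)(b)U₀(b)^* − 1 − tξ(b) = o(t)` bondwise, in particular whenever
`t ↦ γ(t)(b)U₀(b)^*` has derivative `ξ(b)` at `0` for every bond.

WHAT IS PROVED (sorry-free, no definition; [folklore] ∕ cited to the printed step they instantiate):
* §1 `eq_zero_of_forall_mul_add_abs_add_sq_nonneg` (scalar endgame with a linear slack), **`lin_eq_zero_of_isMinOn_of_isLittleO`** (E-L along curves with little-o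
  defect, any lattice, any admissible set), **`lin_eq_zero_of_isMinOn_of_hasDerivAt`** (the same from bondwise `HasDerivAt`);
* §2 **`hasDerivAt_of_implicit_of_lipschitz`** (real normed spaces `E`, `F`; `G : E × ℝ → F` Fréchet differentiable at `(W₀, 0)` with derivative `A`, a bounded
  left inverse `B` of `A(·, 0)`, a solution curve `G(W t, t) = G(W₀, 0)` which is Lipschitz at `0` ⟹ `HasDerivAt W (−B (A (0, 1))) 0`).

References: T. Bałaban, CMP 102 (1985) 277–309 [Balaban1985Variational] ((26)–(27) p.282, (127) p.297, p.300).
-/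

noncomputable section

open scoped BigOperators Matrix.Norms.L2Operator Matrix
open Filter Topology Asymptotics

namespace Summit.QuantumFields.YangMills.Theorems.Prop8Criticality

open Literature.MathematicalPhysics.QuantumFieldTheory.Balaban1983to89
open Finset
open Summit.QuantumFields.YangMills.Theorems.Prop7FlatLocalMin (sum_plaq_bonds_le)

/-! ## §1 The Euler–Lagrange equation along curves with a little-o defect -/

section LittleO

variable {P : Params} {j : ℕ}

/-- Scalar endgame with a linear slack: if `0 ≤ tℓ + (|ℓ|/2)|t| + Kt²` for all `|t| ≤ t₁` (`t₁ > 0`, `K ≥ 0`), then `ℓ = 0`. [folklore] -/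
theorem eq_zero_of_forall_mul_add_abs_add_sq_nonneg {ℓ K t₁ : ℝ} (ht₁ : 0 < t₁) (hK : 0 ≤ K)
    (h : ∀ t : ℝ, |t| ≤ t₁ → 0 ≤ t * ℓ + |ℓ| / 2 * |t| + K * t ^ 2) : ℓ = 0 := by
  by_contra hℓ
  have hℓpos : 0 < |ℓ| := abs_pos.mpr hℓ
  set τ : ℝ := min t₁ (|ℓ| / (4 * (K + 1))) with hτ
  have hK1 : 0 < K + 1 := by linarith
  have hτpos : 0 < τ := lt_min ht₁ (div_pos hℓpos (by linarith))
  have hτ₁ : τ ≤ t₁ := min_le_left _ _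
  have hτ₂' : 4 * (K + 1) * τ ≤ |ℓ| := by
    have := mul_le_mul_of_nonneg_left (min_le_right t₁ (|ℓ| / (4 * (K + 1)))) (by linarith : (0 : ℝ) ≤ 4 * (K + 1))
    rwa [mul_div_cancel₀ _ (by linarith : (4 : ℝ) * (K + 1) ≠ 0)] at this
  rcases lt_or_gt_of_ne hℓ with hneg | hpos
  · have h0 := h τ (by rw [abs_of_pos hτpos]; exact hτ₁)
    rw [abs_of_pos hτpos, abs_of_neg hneg] at h0
    rw [abs_of_neg hneg] at hτ₂'
    -- `0 ≤ τℓ − τℓ/2 + Kτ² = τ(ℓ/2 + Kτ)` and `Kτ ≤ (K+1)τ ≤ −ℓ/4`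
    have h1 : K * τ ≤ -ℓ / 4 := by nlinarith
    have h2 : 0 ≤ τ * (ℓ / 2 + K * τ) := by nlinarith
    have h3 : ℓ / 2 + K * τ < 0 := by linarith
    nlinarith
  · have h0 := h (-τ) (by rw [abs_neg, abs_of_pos hτpos]; exact hτ₁)
    rw [abs_neg, abs_of_pos hτpos, abs_of_pos hpos] at h0
    rw [abs_of_pos hpos] at hτ₂'
    have h1 : K * τ ≤ ℓ / 4 := by nlinarith
    have h2 : 0 ≤ τ * (-ℓ / 2 + K * τ) := by nlinarith
    have h3 : -ℓ / 2 + K * τ < 0 := by linarith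
    nlinarith

/-- **THE EULER–LAGRANGE EQUATION ALONG CURVES, LITTLE-o FORM** (`SU(2)`, any lattice, any admissible set `S`): if `U₀` minimises the Wilson action over
`S`, `γ(t) ∈ S` for `t` near `0`, and `γ(t)(b)U₀(b)^* − 1 − tξ(b) = o(t)` as `t → 0` uniformly in the (finitely many) bonds `b` (stated with an explicit `ε`), then `Lin_{U₀}(ξ) = 0` (same `Lin` as in parts 1–2).
[cite: Balaban1985Variational, (127) p.297, (26)-(27) p.282] -/
theorem lin_eq_zero_of_isMinOn_of_isLittleO {S : Set (GaugeField P j (Matrix.specialUnitaryGroup (Fin 2) ℂ))}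
    {U₀ : GaugeField P j (Matrix.specialUnitaryGroup (Fin 2) ℂ)}
    (hmin : IsMinOn (fun W : GaugeField P j (Matrix.specialUnitaryGroup (Fin 2) ℂ) => wilsonAction4 W) S U₀)
    (γ : ℝ → GaugeField P j (Matrix.specialUnitaryGroup (Fin 2) ℂ)) (hγS : ∀ᶠ t in 𝓝 (0 : ℝ), γ t ∈ S)
    (ξ : PBond P j → Matrix (Fin 2) (Fin 2) ℂ)
    (hγξ : ∀ ε : ℝ, 0 < ε → ∀ᶠ t in 𝓝 (0 : ℝ), ∀ b : PBond P j,
      ‖(γ t b : Matrix (Fin 2) (Fin 2) ℂ) * star (U₀ b : Matrix (Fin 2) (Fin 2) ℂ) - 1 - (t : ℂ) • ξ b‖ ≤ ε * |t|) :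
    ∑ p : Plaq P j, (1 / 2) * ((((((GaugeField.plaqHol U₀ p : Matrix.specialUnitaryGroup (Fin 2) ℂ) : Matrix (Fin 2) (Fin 2) ℂ)) - 1)ᴴ
          * ((ξ ⟨p.src, p.μ⟩
              + (U₀ ⟨p.src, p.μ⟩ : Matrix (Fin 2) (Fin 2) ℂ) * ξ ⟨p.src.shift p.μ, p.ν⟩ * star (U₀ ⟨p.src, p.μ⟩ : Matrix (Fin 2) (Fin 2) ℂ)
              - ((U₀ ⟨p.src, p.μ⟩ * U₀ ⟨p.src.shift p.μ, p.ν⟩ * (U₀ ⟨p.src.shift p.ν, p.μ⟩)⁻¹ : Matrix.specialUnitaryGroup (Fin 2) ℂ) : Matrix (Fin 2) (Fin 2) ℂ)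
                  * ξ ⟨p.src.shift p.ν, p.μ⟩
                  * star ((U₀ ⟨p.src, p.μ⟩ * U₀ ⟨p.src.shift p.μ, p.ν⟩ * (U₀ ⟨p.src.shift p.ν, p.μ⟩)⁻¹ : Matrix.specialUnitaryGroup (Fin 2) ℂ) : Matrix (Fin 2) (Fin 2) ℂ)
              - ((GaugeField.plaqHol U₀ p : Matrix.specialUnitaryGroup (Fin 2) ℂ) : Matrix (Fin 2) (Fin 2) ℂ) * ξ ⟨p.src, p.ν⟩
                  * star ((GaugeField.plaqHol U₀ p : Matrix.specialUnitaryGroup (Fin 2) ℂ) : Matrix (Fin 2) (Fin 2) ℂ))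
            * ((GaugeField.plaqHol U₀ p : Matrix.specialUnitaryGroup (Fin 2) ℂ) : Matrix (Fin 2) (Fin 2) ℂ))).trace).re = 0 := by
  -- the first variation as a function of the bond field
  set Λ : (PBond P j → Matrix (Fin 2) (Fin 2) ℂ) → ℝ := fun Z =>
    ∑ p : Plaq P j, (1 / 2) * ((((((GaugeField.plaqHol U₀ p : Matrix.specialUnitaryGroup (Fin 2) ℂ) : Matrix (Fin 2) (Fin 2) ℂ)) - 1)ᴴ
          * ((Z ⟨p.src, p.μ⟩
              + (U₀ ⟨p.src, p.μ⟩ : Matrix (Fin 2) (Fin 2) ℂ) * Z ⟨p.src.shift p.μ, p.ν⟩ * star (U₀ ⟨p.src, p.μ⟩ : Matrix (Fin 2) (Fin 2) ℂ)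
              - ((U₀ ⟨p.src, p.μ⟩ * U₀ ⟨p.src.shift p.μ, p.ν⟩ * (U₀ ⟨p.src.shift p.ν, p.μ⟩)⁻¹ : Matrix.specialUnitaryGroup (Fin 2) ℂ) : Matrix (Fin 2) (Fin 2) ℂ)
                  * Z ⟨p.src.shift p.ν, p.μ⟩
                  * star ((U₀ ⟨p.src, p.μ⟩ * U₀ ⟨p.src.shift p.μ, p.ν⟩ * (U₀ ⟨p.src.shift p.ν, p.μ⟩)⁻¹ : Matrix.specialUnitaryGroup (Fin 2) ℂ) : Matrix (Fin 2) (Fin 2) ℂ)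
              - ((GaugeField.plaqHol U₀ p : Matrix.specialUnitaryGroup (Fin 2) ℂ) : Matrix (Fin 2) (Fin 2) ℂ) * Z ⟨p.src, p.ν⟩
                  * star ((GaugeField.plaqHol U₀ p : Matrix.specialUnitaryGroup (Fin 2) ℂ) : Matrix (Fin 2) (Fin 2) ℂ))
            * ((GaugeField.plaqHol U₀ p : Matrix.specialUnitaryGroup (Fin 2) ℂ) : Matrix (Fin 2) (Fin 2) ℂ))).trace).re with hΛ
  change Λ ξ = 0
  set Y : ℝ → PBond P j → Matrix (Fin 2) (Fin 2) ℂ := fun t b =>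
    (γ t b : Matrix (Fin 2) (Fin 2) ℂ) * star (U₀ b : Matrix (Fin 2) (Fin 2) ℂ) - 1 with hY
  set M : ℝ := ∑ b : PBond P j, ‖ξ b‖ with hM
  set B : ℝ := (Fintype.card (PBond P j) : ℝ) with hB
  set D : ℝ := (P.d : ℝ) with hD
  have hM0 : 0 ≤ M := Finset.sum_nonneg fun b _ => norm_nonneg _
  have hB0 : 0 ≤ B := Nat.cast_nonneg _
  have hD0 : 0 ≤ D := Nat.cast_nonneg _
  have hMb : ∀ b : PBond P j, ‖ξ b‖ ≤ M := fun b =>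
    Finset.single_le_sum (f := fun b => ‖ξ b‖) (fun b _ => norm_nonneg _) (Finset.mem_univ b)
  -- (1) linearity and the `ℓ¹` bound of `Λ`
  have hlin : ∀ t : ℝ, Λ (Y t) - t * Λ ξ = Λ (fun b => Y t b - (t : ℂ) • ξ b) := by
    intro t
    simp only [hΛ, Finset.mul_sum, ← Finset.sum_sub_distrib]
    exact Finset.sum_congr rfl fun p _ => linPlaq_sub_smul U₀ (Y t) ξ t p
  have hΛle : ∀ W : PBond P j → Matrix (Fin 2) (Fin 2) ℂ, |Λ W| ≤ 2 * (4 * D) * ∑ b : PBond P j, ‖W b‖ := by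
    intro W
    simp only [hΛ]
    refine (Finset.abs_sum_le_sum_abs _ _).trans ?_
    have hper : ∀ p : Plaq P j, _ ≤ 2 * (‖W ⟨p.src, p.μ⟩‖ + ‖W ⟨p.src.shift p.μ, p.ν⟩‖ + ‖W ⟨p.src.shift p.ν, p.μ⟩‖ + ‖W ⟨p.src, p.ν⟩‖) :=
      fun p => (abs_linPlaq_le U₀ W p).trans (mul_le_mul_of_nonneg_right (norm_coe_sub_one_le_two _) (by positivity))
    refine (Finset.sum_le_sum fun p _ => hper p).trans ?_
    rw [← Finset.mul_sum, mul_assoc]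
    exact mul_le_mul_of_nonneg_left (sum_plaq_bonds_le (fun b => ‖W b‖) fun b => norm_nonneg _) zero_le_two
  -- (2) the slack `ε` and a common window
  set ℓ : ℝ := Λ ξ with hℓ
  clear_value ℓ
  set ε : ℝ := |ℓ| / 2 / (2 * (4 * D) * B + 1) with hε
  have hε0 : 0 ≤ ε := by positivity
  have hεslack : 2 * (4 * D) * B * ε ≤ |ℓ| / 2 := by
    have h1 : 2 * (4 * D) * B * ε ≤ (2 * (4 * D) * B + 1) * ε := mul_le_mul_of_nonneg_right (le_add_of_nonneg_right zero_le_one) hε0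
    rw [hε, mul_div_cancel₀ _ (by positivity : (2 : ℝ) * (4 * D) * B + 1 ≠ 0)] at h1
    exact h1
  by_cases hℓ0 : ℓ = 0
  · exact hℓ0
  have hεpos : 0 < ε := by
    have : 0 < |ℓ| := abs_pos.mpr hℓ0
    positivity
  have hdef : ∀ᶠ t in 𝓝 (0 : ℝ), ∀ b : PBond P j, ‖Y t b - (t : ℂ) • ξ b‖ ≤ ε * |t| := hγξ ε hεpos
  -- the window `|t| ≤ t₁`: fluctuations `≤ |t|(M + ε) ≤ 1/4`
  set t₁ : ℝ := 1 / (4 * (M + ε) + 1) with ht₁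
  have ht₁pos : 0 < t₁ := by positivity
  have hwin : t₁ * (M + ε) ≤ 1 / 4 := by
    have h1 : t₁ * (4 * (M + ε) + 1) = 1 := by rw [ht₁, div_mul_cancel₀ _ (by positivity : (4 : ℝ) * (M + ε) + 1 ≠ 0)]
    have h2 : t₁ * (M + ε) = (1 - t₁) / 4 := by linear_combination h1 / 4
    rw [h2]
    linarith only [ht₁pos]
  have hsmall : ∀ᶠ t in 𝓝 (0 : ℝ), |t| < t₁ := by
    have := Metric.ball_mem_nhds (0 : ℝ) ht₁pos
    filter_upwards [this] with t ht
    rwa [Metric.mem_ball, Real.dist_eq, sub_zero] at ht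
  obtain ⟨ρ, hρ, hall⟩ := Metric.eventually_nhds_iff.mp (hγS.and (hdef.and hsmall))
  -- (3) for `|t| ≤ ρ/2`: `0 ≤ tℓ + (|ℓ|/2)|t| + Kt²`
  have key : ∀ t : ℝ, |t| ≤ ρ / 2 → 0 ≤ t * ℓ + |ℓ| / 2 * |t| + ((8 * 2 + 18) * (4 * D) * (B * (M + ε) ^ 2)) * t ^ 2 := by
    intro t ht
    have hdist : dist t 0 < ρ := by rw [Real.dist_eq, sub_zero]; linarith only [ht, hρ]
    obtain ⟨hS, hZ, htt₁⟩ := hall hdist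
    have hYb : ∀ b : PBond P j, ‖Y t b‖ ≤ |t| * (M + ε) := by
      intro b
      have h1 := hZ b
      have h2 : ‖(t : ℂ) • ξ b‖ = |t| * ‖ξ b‖ := by rw [norm_smul, Complex.norm_real, Real.norm_eq_abs]
      have h3 : ‖Y t b‖ ≤ ‖(t : ℂ) • ξ b‖ + ‖Y t b - (t : ℂ) • ξ b‖ := by
        have := norm_add_le ((t : ℂ) • ξ b) (Y t b - (t : ℂ) • ξ b); rwa [add_sub_cancel] at this
      have h5 := hMb b
      have h6 : |t| * ‖ξ b‖ ≤ |t| * M := mul_le_mul_of_nonneg_left h5 (abs_nonneg t)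
      calc ‖Y t b‖ ≤ ‖(t : ℂ) • ξ b‖ + ‖Y t b - (t : ℂ) • ξ b‖ := h3
        _ ≤ |t| * M + ε * |t| := by rw [h2]; exact add_le_add h6 h1
        _ = |t| * (M + ε) := by ring
    have hδ : ∀ b : PBond P j, ‖(γ t b : Matrix (Fin 2) (Fin 2) ℂ) * star (U₀ b : Matrix (Fin 2) (Fin 2) ℂ) - 1‖ ≤ |t| * (M + ε) := hYb
    have hδ4 : |t| * (M + ε) ≤ 1 / 4 := (mul_le_mul_of_nonneg_right htt₁.le (by positivity)).trans hwin
    have h2 := abs_wilsonAction4_sub_sub_lin_le (γ t) U₀ zero_le_two (fun p => norm_coe_sub_one_le_two _) hδ hδ4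
    change |wilsonAction4 (γ t) - wilsonAction4 U₀ - Λ (Y t)| ≤ (8 * 2 + 18) * (4 * P.d) * ∑ b : PBond P j, ‖Y t b‖ ^ 2 at h2
    have h0 : 0 ≤ wilsonAction4 (γ t) - wilsonAction4 U₀ := sub_nonneg.mpr (hmin hS)
    have hs1 : ∑ b : PBond P j, ‖Y t b‖ ^ 2 ≤ B * (|t| * (M + ε)) ^ 2 := by
      calc ∑ b : PBond P j, ‖Y t b‖ ^ 2 ≤ ∑ _b : PBond P j, (|t| * (M + ε)) ^ 2 :=
            Finset.sum_le_sum fun b _ => pow_le_pow_left₀ (norm_nonneg _) (hYb b) 2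
        _ = B * (|t| * (M + ε)) ^ 2 := by rw [Finset.sum_const, Finset.card_univ, nsmul_eq_mul]
    have hs2 : ∑ b : PBond P j, ‖Y t b - (t : ℂ) • ξ b‖ ≤ B * (ε * |t|) := by
      calc ∑ b : PBond P j, ‖Y t b - (t : ℂ) • ξ b‖ ≤ ∑ _b : PBond P j, ε * |t| := Finset.sum_le_sum fun b _ => hZ b
        _ = B * (ε * |t|) := by rw [Finset.sum_const, Finset.card_univ, nsmul_eq_mul]
    have h3 := hΛle (fun b => Y t b - (t : ℂ) • ξ b)
    rw [← hlin t] at h3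
    have habs2 := abs_le.mp h2
    have habs3 := abs_le.mp h3
    have ht2 : (|t| * (M + ε)) ^ 2 = (M + ε) ^ 2 * t ^ 2 := by rw [mul_pow, sq_abs]; ring
    rw [ht2] at hs1
    have e1 : (8 * 2 + 18) * (4 * (P.d : ℝ)) * ∑ b : PBond P j, ‖Y t b‖ ^ 2 ≤ (8 * 2 + 18) * (4 * D) * (B * ((M + ε) ^ 2 * t ^ 2)) :=
      mul_le_mul_of_nonneg_left hs1 (by positivity)
    have e2 : 2 * (4 * D) * ∑ b : PBond P j, ‖Y t b - (t : ℂ) • ξ b‖ ≤ 2 * (4 * D) * (B * (ε * |t|)) :=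
      mul_le_mul_of_nonneg_left hs2 (by positivity)
    have e3 : 2 * (4 * D) * (B * (ε * |t|)) ≤ |ℓ| / 2 * |t| := by
      have := mul_le_mul_of_nonneg_right hεslack (abs_nonneg t)
      linarith only [this]
    nlinarith only [habs2.1, habs2.2, habs3.1, habs3.2, e1, e2, e3, h0]
  exact eq_zero_of_forall_mul_add_abs_add_sq_nonneg (half_pos hρ) (by positivity) key

/-- **THE EULER–LAGRANGE EQUATION ALONG DIFFERENTIABLE CURVES**: if `U₀` minimises the Wilson action over `S`, `γ(t) ∈ S` near `t = 0`, `γ(0) = U₀`, and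
every bond coordinate `t ↦ γ(t)(b)U₀(b)^*` is differentiable at `0` with derivative `ξ(b)`, then `Lin_{U₀}(ξ) = 0`. [cite: Balaban1985Variational, (127) p.297] -/
theorem lin_eq_zero_of_isMinOn_of_hasDerivAt {S : Set (GaugeField P j (Matrix.specialUnitaryGroup (Fin 2) ℂ))}
    {U₀ : GaugeField P j (Matrix.specialUnitaryGroup (Fin 2) ℂ)}
    (hmin : IsMinOn (fun W : GaugeField P j (Matrix.specialUnitaryGroup (Fin 2) ℂ) => wilsonAction4 W) S U₀)
    (γ : ℝ → GaugeField P j (Matrix.specialUnitaryGroup (Fin 2) ℂ)) (hγS : ∀ᶠ t in 𝓝 (0 : ℝ), γ t ∈ S) (hγ0 : γ 0 = U₀)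
    (ξ : PBond P j → Matrix (Fin 2) (Fin 2) ℂ)
    (hγξ : ∀ b : PBond P j,
      HasDerivAt (fun t : ℝ => (γ t b : Matrix (Fin 2) (Fin 2) ℂ) * star (U₀ b : Matrix (Fin 2) (Fin 2) ℂ)) (ξ b) 0) :
    ∑ p : Plaq P j, (1 / 2) * ((((((GaugeField.plaqHol U₀ p : Matrix.specialUnitaryGroup (Fin 2) ℂ) : Matrix (Fin 2) (Fin 2) ℂ)) - 1)ᴴ
          * ((ξ ⟨p.src, p.μ⟩
              + (U₀ ⟨p.src, p.μ⟩ : Matrix (Fin 2) (Fin 2) ℂ) * ξ ⟨p.src.shift p.μ, p.ν⟩ * star (U₀ ⟨p.src, p.μ⟩ : Matrix (Fin 2) (Fin 2) ℂ)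
              - ((U₀ ⟨p.src, p.μ⟩ * U₀ ⟨p.src.shift p.μ, p.ν⟩ * (U₀ ⟨p.src.shift p.ν, p.μ⟩)⁻¹ : Matrix.specialUnitaryGroup (Fin 2) ℂ) : Matrix (Fin 2) (Fin 2) ℂ)
                  * ξ ⟨p.src.shift p.ν, p.μ⟩
                  * star ((U₀ ⟨p.src, p.μ⟩ * U₀ ⟨p.src.shift p.μ, p.ν⟩ * (U₀ ⟨p.src.shift p.ν, p.μ⟩)⁻¹ : Matrix.specialUnitaryGroup (Fin 2) ℂ) : Matrix (Fin 2) (Fin 2) ℂ)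
              - ((GaugeField.plaqHol U₀ p : Matrix.specialUnitaryGroup (Fin 2) ℂ) : Matrix (Fin 2) (Fin 2) ℂ) * ξ ⟨p.src, p.ν⟩
                  * star ((GaugeField.plaqHol U₀ p : Matrix.specialUnitaryGroup (Fin 2) ℂ) : Matrix (Fin 2) (Fin 2) ℂ))
            * ((GaugeField.plaqHol U₀ p : Matrix.specialUnitaryGroup (Fin 2) ℂ) : Matrix (Fin 2) (Fin 2) ℂ))).trace).re = 0 := by
  refine lin_eq_zero_of_isMinOn_of_isLittleO hmin γ hγS ξ fun ε hε => ?_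
  refine Filter.eventually_all.mpr fun b => ?_
  have h1 := (hasDerivAt_iff_isLittleO_nhds_zero).mp (hγξ b)
  have h0 : (γ 0 b : Matrix (Fin 2) (Fin 2) ℂ) * star (U₀ b : Matrix (Fin 2) (Fin 2) ℂ) = 1 := by
    rw [hγ0]; exact Matrix.mem_unitaryGroup_iff.mp (U₀ b).2.1
  filter_upwards [h1.def hε] with t ht
  rw [zero_add, h0, Real.norm_eq_abs] at ht
  rwa [Complex.coe_smul]

end LittleO

/-! ## §2 Differentiability of Lipschitz implicit solutions -/

section Implicit

variable {E F : Type*} [NormedAddCommGroup E] [NormedSpace ℝ E] [NormedAddCommGroup F] [NormedSpace ℝ F]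

/-- **DIFFERENTIABILITY OF A LIPSCHITZ IMPLICIT SOLUTION.**  If `G : E × ℝ → F` is Fréchet differentiable at `(W₀, 0)` with derivative `A`, the partial
derivative `A(·, 0)` has a bounded left inverse `B`, and `W : ℝ → E` with `W 0 = W₀` solves `G (W t, t) = G (W₀, 0)` near `0` and is Lipschitz at `0`
(`‖W t − W₀‖ ≤ C|t|`), then `W` is differentiable at `0` with derivative `−B (A (0, 1))` — the implicit-function derivative, obtained without an implicit
function theorem once a (unique or not) Lipschitz solution branch is GIVEN (here: by the exact corrector of the block averaging). [folklore] -/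
theorem hasDerivAt_of_implicit_of_lipschitz {G : E × ℝ → F} {A : E × ℝ →L[ℝ] F} {W₀ : E} (hG : HasFDerivAt G A (W₀, 0))
    {B : F →L[ℝ] E} (hB : ∀ X : E, B (A (X, 0)) = X) {W : ℝ → E} (hW0 : W 0 = W₀)
    (hsol : ∀ᶠ t in 𝓝 (0 : ℝ), G (W t, t) = G (W₀, 0)) {C : ℝ} (hLip : ∀ᶠ t in 𝓝 (0 : ℝ), ‖W t - W₀‖ ≤ C * |t|) :
    HasDerivAt W (-B (A (0, 1))) 0 := by
  -- the curve `t ↦ (W t, t)` tends to `(W₀, 0)` and is `O(t)`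
  have hcurve : (fun t : ℝ => ((W t, t) : E × ℝ) - (W₀, 0)) =O[𝓝 (0 : ℝ)] fun t => t := by
    refine IsBigO.of_bound (max C 1) ?_
    filter_upwards [hLip] with t ht
    rw [Prod.norm_def]
    simp only [Prod.fst_sub, Prod.snd_sub, sub_zero, Real.norm_eq_abs]
    refine max_le ?_ ?_
    · exact ht.trans (mul_le_mul_of_nonneg_right (le_max_left _ _) (abs_nonneg t))
    · calc |t| = 1 * |t| := (one_mul _).symm
        _ ≤ max C 1 * |t| := mul_le_mul_of_nonneg_right (le_max_right _ _) (abs_nonneg t)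
  have htend : Tendsto (fun t : ℝ => ((W t, t) : E × ℝ)) (𝓝 0) (𝓝 (W₀, 0)) := by
    have h1 : Tendsto (fun t : ℝ => ((W t, t) : E × ℝ) - (W₀, 0)) (𝓝 0) (𝓝 0) :=
      hcurve.trans_tendsto (continuous_id.tendsto' (0:ℝ) 0 rfl)
    have h2 := h1.add_const ((W₀, 0) : E × ℝ)
    simpa using h2
  -- the Taylor remainder of `G` along the curve is `o(t)`
  have hrem : (fun t : ℝ => G (W t, t) - G (W₀, 0) - A ((W t, t) - (W₀, 0))) =o[𝓝 (0 : ℝ)] fun t => t := by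
    have h1 := hG.isLittleO.comp_tendsto htend
    exact h1.trans_isBigO hcurve
  -- along the curve `G` is constant, so `A (W t − W₀, t) = o(t)`
  have hA : (fun t : ℝ => A ((W t, t) - (W₀, 0))) =o[𝓝 (0 : ℝ)] fun t => t := by
    have h2 : (fun t : ℝ => G (W t, t) - G (W₀, 0) - A ((W t, t) - (W₀, 0))) =ᶠ[𝓝 0] fun t => -A ((W t, t) - (W₀, 0)) := by
      filter_upwards [hsol] with t ht
      rw [ht, sub_self, zero_sub]
    have := (hrem.congr' h2 (EventuallyEq.refl _ _)).neg_left
    simpa using this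
  -- split `A (X, s) = A (X, 0) + s • A (0, 1)` and apply the left inverse
  have hsplit : ∀ (X : E) (s : ℝ), A (X, s) = A (X, 0) + s • A (0, 1) := by
    intro X s
    have : ((X, s) : E × ℝ) = (X, 0) + s • ((0 : E), (1 : ℝ)) := by simp
    rw [this, map_add, map_smul]
  have hB' : (fun t : ℝ => B (A ((W t, t) - (W₀, 0)))) =o[𝓝 (0 : ℝ)] fun t => t := (B.isBigO_comp _ _).trans_isLittleO hA
  have hkey : (fun t : ℝ => W t - W₀ - t • (-B (A (0, 1)))) =o[𝓝 (0 : ℝ)] fun t => t := by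
    refine hB'.congr' ?_ (EventuallyEq.refl _ _)
    filter_upwards with t
    rw [Prod.mk_sub_mk, sub_zero, hsplit, map_add, map_smul, hB, smul_neg, sub_neg_eq_add]
  rw [hasDerivAt_iff_isLittleO_nhds_zero]
  refine hkey.congr' ?_ (EventuallyEq.refl _ _)
  filter_upwards with t
  rw [zero_add, hW0]

end Implicit

end Summit.QuantumFields.YangMills.Theorems.Prop8Criticality

end
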